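import Summits.QuantumAdvantage.QuantumAdvantage.Theses.LinnikCubicClassGroups
import Literature.NumberTheory.CubicFields.PureCubicInverseProgram

/-!
# Crux `LinnikCubicClassGroups.PureCubicClassGroupFBQP` (stmt-QuantumAdvantage-11544) — stub `stub_cubicWalkOpsFP`

Line `arakelov-giant-step-cycle`, stub `stub_cubicWalkOpsFP` (S3b-P4): the PROGRAMMING LAYER of the cubic
infrastructure. The lattice/element programs of the neighbouring stubs (`mulE`, `normE`, `latScale`,
`latProd`, `lexE`, `logE`, `ordL`) are black boxes known only through their `CodeFP` facts (and, for the
algebraic specifications, the norm form of the basis `(1, θ, θ₂ = θ²/b)` and the specification of `normE`).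
We produce polynomial-time programs on codes for

* `invE` — the inverse of an element code, by the adjugate of the cubic form
  (`Literature/NumberTheory/CubicFields/PureCubicInverseProgram.lean`, `exists_cubic_invE`);
* `isBigL` — the exact big-gap test `0 ≤ N(10γ − 11)` for `γ = lexE`, through `normE` (`exists_cubic_isBigL`);
* `redL` — one reduction step (`latScale` by `invE ∘ lexE`, and the `logE` of `lexE`), two literal equations;
* the loops `rhoS`, `starS`, `unitS` — literal iterates (`7`, `6`, `6` times) of one step function, computed on
  codes by composing the step with itself (`codeFP_iterate`).
-/

namespace Summit.QuantumAdvantage.QuantumAdvantage.Theorems.LinnikCubicClassGroups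

open Literature.Computability.Complexity (CodeFP)
open Literature.Computability.Complexity.CodeFP (pairE natE intE bitE unE rawE fst snd const)
open Literature.NumberTheory.CubicFields.PureCubicWalkOps (codeFP_zadd codeFP_iterate exists_cubic_invE
  exists_cubic_isBigL)
open scoped NumberField

/-! ### One reduction step -/

/-- **The reduction step `redL`**: two literal equations. -/
theorem exists_cubic_redL (latScale : (ℕ × ℕ) × ((ℕ × List ℤ) × (ℤ × ℤ × ℤ × ℕ)) → ℕ × List ℤ)
    (lexE : (ℕ × ℕ) × (ℕ × List ℤ) → ℤ × ℤ × ℤ × ℕ) (logE : (ℕ × ℕ) × ((ℤ × ℤ × ℤ × ℕ) × ℕ) → ℤ)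
    (invE : (ℕ × ℕ) × (ℤ × ℤ × ℤ × ℕ) → ℤ × ℤ × ℤ × ℕ)
    (hlatScale : CodeFP (pairE (pairE natE natE) (pairE (pairE natE (rawE intE)) (pairE intE (pairE intE (pairE intE natE)))))
      (pairE natE (rawE intE)) latScale)
    (hlexE : CodeFP (pairE (pairE natE natE) (pairE natE (rawE intE))) (pairE intE (pairE intE (pairE intE natE))) lexE)
    (hlogE : CodeFP (pairE (pairE natE natE) (pairE (pairE intE (pairE intE (pairE intE natE))) unE)) intE logE)
    (hinvE : CodeFP (pairE (pairE natE natE) (pairE intE (pairE intE (pairE intE natE))))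
      (pairE intE (pairE intE (pairE intE natE))) invE) :
    ∃ redL : ((ℕ × ℕ) × ℕ) × (ℕ × List ℤ) → (ℕ × List ℤ) × ℤ,
      CodeFP (pairE (pairE (pairE natE natE) unE) (pairE natE (rawE intE))) (pairE (pairE natE (rawE intE)) intE) redL ∧
      ∀ (a b prec : ℕ) (c : ℕ × List ℤ),
        (redL (((a, b), prec), c)).1 = latScale ((a, b), (c, invE ((a, b), lexE ((a, b), c)))) ∧
        (redL (((a, b), prec), c)).2 = logE ((a, b), (lexE ((a, b), c), prec)) := by
  let R := pairE (pairE (pairE natE natE) unE) (pairE natE (rawE intE))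
  have hab : CodeFP R (pairE natE natE) (fun q : ((ℕ × ℕ) × ℕ) × (ℕ × List ℤ) => q.1.1) := (fst _ _).fst'
  have hprec : CodeFP R unE (fun q : ((ℕ × ℕ) × ℕ) × (ℕ × List ℤ) => q.1.2) := (fst _ _).snd'
  have hc : CodeFP R (pairE natE (rawE intE)) (fun q : ((ℕ × ℕ) × ℕ) × (ℕ × List ℤ) => q.2) := snd _ _
  have hlex : CodeFP R (pairE intE (pairE intE (pairE intE natE))) (fun q => lexE (q.1.1, q.2)) :=
    hlexE.comp (hab.pair hc)
  have hinv : CodeFP R (pairE intE (pairE intE (pairE intE natE))) (fun q => invE (q.1.1, lexE (q.1.1, q.2))) :=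
    hinvE.comp (hab.pair hlex)
  have h1 : CodeFP R (pairE natE (rawE intE)) (fun q => latScale (q.1.1, (q.2, invE (q.1.1, lexE (q.1.1, q.2))))) :=
    hlatScale.comp (hab.pair (hc.pair hinv))
  have h2 : CodeFP R intE (fun q => logE (q.1.1, (lexE (q.1.1, q.2), q.1.2))) := hlogE.comp (hab.pair (hlex.pair hprec))
  exact ⟨_, h1.pair h2, fun _ _ _ _ => ⟨rfl, rfl⟩⟩

/-! ### The loops -/

/-- **The three loops `rhoS`, `starS`, `unitS`** as literal iterates of the step
"if flagged, stay; else reduce once, add the log, flag := big-gap test", computed on codes by composition. -/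
theorem exists_cubic_loops (latProd : (ℕ × ℕ) × ((ℕ × List ℤ) × (ℕ × List ℤ)) → ℕ × List ℤ)
    (ordL : ℕ × ℕ → ℕ × List ℤ) (redL : ((ℕ × ℕ) × ℕ) × (ℕ × List ℤ) → (ℕ × List ℤ) × ℤ)
    (isBigL : (ℕ × ℕ) × (ℕ × List ℤ) → Bool)
    (hlatProd : CodeFP (pairE (pairE natE natE) (pairE (pairE natE (rawE intE)) (pairE natE (rawE intE)))) (pairE natE (rawE intE)) latProd)
    (hordL : CodeFP (pairE natE natE) (pairE natE (rawE intE)) ordL)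
    (hredL : CodeFP (pairE (pairE (pairE natE natE) unE) (pairE natE (rawE intE))) (pairE (pairE natE (rawE intE)) intE) redL)
    (hisBigL : CodeFP (pairE (pairE natE natE) (pairE natE (rawE intE))) bitE isBigL) :
    ∃ (rhoS : ((ℕ × ℕ) × ℕ) × (ℕ × List ℤ) → (ℕ × List ℤ) × ℤ)
      (starS : ((ℕ × ℕ) × ℕ) × ((ℕ × List ℤ) × (ℕ × List ℤ)) → (ℕ × List ℤ) × ℤ)
      (unitS : (ℕ × ℕ) × ℕ → (ℕ × List ℤ) × ℤ),
      CodeFP (pairE (pairE (pairE natE natE) unE) (pairE natE (rawE intE))) (pairE (pairE natE (rawE intE)) intE) rhoS ∧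
      CodeFP (pairE (pairE (pairE natE natE) unE) (pairE (pairE natE (rawE intE)) (pairE natE (rawE intE))))
        (pairE (pairE natE (rawE intE)) intE) starS ∧
      CodeFP (pairE (pairE natE natE) unE) (pairE (pairE natE (rawE intE)) intE) unitS ∧
      (∀ (a b prec : ℕ) (c : ℕ × List ℤ), rhoS (((a, b), prec), c) =
        (((fun s : ((ℕ × List ℤ) × ℤ) × Bool => if s.2 = true then s else
            (((redL (((a, b), prec), s.1.1)).1, s.1.2 + (redL (((a, b), prec), s.1.1)).2), isBigL ((a, b), (redL (((a, b), prec), s.1.1)).1))))^[7]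
          ((c, 0), false)).1) ∧
      (∀ (a b prec : ℕ) (c₁ c₂ : ℕ × List ℤ), starS (((a, b), prec), (c₁, c₂)) =
        (((fun s : ((ℕ × List ℤ) × ℤ) × Bool => if s.2 = true then s else
            (((redL (((a, b), prec), s.1.1)).1, s.1.2 + (redL (((a, b), prec), s.1.1)).2), isBigL ((a, b), (redL (((a, b), prec), s.1.1)).1))))^[6]
          (((redL (((a, b), prec), latProd ((a, b), (c₁, c₂)))).1, (redL (((a, b), prec), latProd ((a, b), (c₁, c₂)))).2),
            isBigL ((a, b), (redL (((a, b), prec), latProd ((a, b), (c₁, c₂)))).1))).1) ∧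
      (∀ (a b prec : ℕ), unitS ((a, b), prec) =
        (((fun s : ((ℕ × List ℤ) × ℤ) × Bool => if s.2 = true then s else
            (((redL (((a, b), prec), s.1.1)).1, s.1.2 + (redL (((a, b), prec), s.1.1)).2), isBigL ((a, b), (redL (((a, b), prec), s.1.1)).1))))^[6]
          ((ordL (a, b), 0), isBigL ((a, b), ordL (a, b)))).1) := by
  -- codes of contexts `((a, b), prec)`, lattices and loop states `((lattice, log), flag)`
  let cE := pairE (pairE natE natE) unE
  let lE := pairE natE (rawE intE)
  let sE := pairE (pairE lE intE) bitE
  -- the step with its context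
  have hR : CodeFP (pairE cE sE) (pairE lE intE)
      (fun t : ((ℕ × ℕ) × ℕ) × (((ℕ × List ℤ) × ℤ) × Bool) => redL (t.1, t.2.1.1)) :=
    hredL.comp ((fst _ _).pair (snd _ _).fst'.fst')
  have hnew : CodeFP (pairE cE sE) sE (fun t : ((ℕ × ℕ) × ℕ) × (((ℕ × List ℤ) × ℤ) × Bool) =>
      (((redL (t.1, t.2.1.1)).1, t.2.1.2 + (redL (t.1, t.2.1.1)).2), isBigL (t.1.1, (redL (t.1, t.2.1.1)).1))) :=
    (hR.fst'.pair (codeFP_zadd (snd _ _).fst'.snd' hR.snd')).pair (hisBigL.comp ((fst _ _).fst'.pair hR.fst'))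
  have hstep : CodeFP (pairE cE sE) sE (fun t : ((ℕ × ℕ) × ℕ) × (((ℕ × List ℤ) × ℤ) × Bool) =>
      if t.2.2 = true then t.2 else
        (((redL (t.1, t.2.1.1)).1, t.2.1.2 + (redL (t.1, t.2.1.1)).2), isBigL (t.1.1, (redL (t.1, t.2.1.1)).1))) :=
    (snd _ _).snd'.ite (snd _ _) hnew
  have hit := fun n => codeFP_iterate hstep n
  -- initial states
  have hinitρ : CodeFP (pairE cE lE) sE (fun q : ((ℕ × ℕ) × ℕ) × (ℕ × List ℤ) => ((q.2, (0 : ℤ)), false)) :=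
    ((snd _ _).pair (const _ (0 : ℤ))).pair (const _ false)
  have hP : CodeFP (pairE cE (pairE lE lE)) lE
      (fun q : ((ℕ × ℕ) × ℕ) × ((ℕ × List ℤ) × (ℕ × List ℤ)) => latProd (q.1.1, q.2)) :=
    hlatProd.comp ((fst _ _).fst'.pair (snd _ _))
  have hR0 : CodeFP (pairE cE (pairE lE lE)) (pairE lE intE)
      (fun q : ((ℕ × ℕ) × ℕ) × ((ℕ × List ℤ) × (ℕ × List ℤ)) => redL (q.1, latProd (q.1.1, q.2))) :=
    hredL.comp ((fst _ _).pair hP)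
  have hinitσ : CodeFP (pairE cE (pairE lE lE)) sE (fun q : ((ℕ × ℕ) × ℕ) × ((ℕ × List ℤ) × (ℕ × List ℤ)) =>
      (((redL (q.1, latProd (q.1.1, q.2))).1, (redL (q.1, latProd (q.1.1, q.2))).2),
        isBigL (q.1.1, (redL (q.1, latProd (q.1.1, q.2))).1))) :=
    (hR0.fst'.pair hR0.snd').pair (hisBigL.comp ((fst _ _).fst'.pair hR0.fst'))
  have hO : CodeFP cE lE (fun q : (ℕ × ℕ) × ℕ => ordL q.1) := hordL.comp (fst _ _)
  have hinitυ : CodeFP cE sE (fun q : (ℕ × ℕ) × ℕ => ((ordL q.1, (0 : ℤ)), isBigL (q.1, ordL q.1))) :=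
    (hO.pair (const _ (0 : ℤ))).pair (hisBigL.comp ((fst _ _).pair hO))
  refine ⟨fun q => (((fun s : ((ℕ × List ℤ) × ℤ) × Bool => if s.2 = true then s else
        (((redL (q.1, s.1.1)).1, s.1.2 + (redL (q.1, s.1.1)).2), isBigL (q.1.1, (redL (q.1, s.1.1)).1))))^[7]
      ((q.2, 0), false)).1,
    fun q => (((fun s : ((ℕ × List ℤ) × ℤ) × Bool => if s.2 = true then s else
        (((redL (q.1, s.1.1)).1, s.1.2 + (redL (q.1, s.1.1)).2), isBigL (q.1.1, (redL (q.1, s.1.1)).1))))^[6]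
      (((redL (q.1, latProd (q.1.1, q.2))).1, (redL (q.1, latProd (q.1.1, q.2))).2),
        isBigL (q.1.1, (redL (q.1, latProd (q.1.1, q.2))).1))).1,
    fun q => (((fun s : ((ℕ × List ℤ) × ℤ) × Bool => if s.2 = true then s else
        (((redL (q, s.1.1)).1, s.1.2 + (redL (q, s.1.1)).2), isBigL (q.1, (redL (q, s.1.1)).1))))^[6]
      ((ordL q.1, 0), isBigL (q.1, ordL q.1))).1,
    (((hit 7).comp ((fst _ _).pair hinitρ)).fst' :), (((hit 6).comp ((fst _ _).pair hinitσ)).fst' :),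
    (((hit 6).comp ((CodeFP.id cE).pair hinitυ)).fst' :),
    fun _ _ _ _ => rfl, fun _ _ _ _ _ => rfl, fun _ _ _ => rfl⟩

/-! ### The stub and its short handle -/

/-- **Short handle `stub_cubicWalkOpsFPCore`** (the registry truncates long signatures; this is the operational
core of `stub_cubicWalkOpsFP`, proved in this file): for ANY polynomial-time programs `latProd`, `ordL`, `redL`,
`isBigL` on lattice codes, the three loops of the cubic infrastructure walk — the filtered baby step `rhoS`, the
filtered giant step `starS` and the start-up `unitS`, specified as literal iterates of the step "if flagged stay,
else reduce once, add the log, flag := big-gap test" — are polynomial-time programs on codes. -/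
theorem stub_cubicWalkOpsFPCore :
    ∀ (latProd : (ℕ × ℕ) × ((ℕ × List ℤ) × (ℕ × List ℤ)) → ℕ × List ℤ) (ordL : ℕ × ℕ → ℕ × List ℤ)
      (redL : ((ℕ × ℕ) × ℕ) × (ℕ × List ℤ) → (ℕ × List ℤ) × ℤ) (isBigL : (ℕ × ℕ) × (ℕ × List ℤ) → Bool),
      CodeFP (pairE (pairE natE natE) (pairE (pairE natE (rawE intE)) (pairE natE (rawE intE)))) (pairE natE (rawE intE)) latProd →
      CodeFP (pairE natE natE) (pairE natE (rawE intE)) ordL →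
      CodeFP (pairE (pairE (pairE natE natE) unE) (pairE natE (rawE intE))) (pairE (pairE natE (rawE intE)) intE) redL →
      CodeFP (pairE (pairE natE natE) (pairE natE (rawE intE))) bitE isBigL →
    ∃ (rhoS : ((ℕ × ℕ) × ℕ) × (ℕ × List ℤ) → (ℕ × List ℤ) × ℤ)
      (starS : ((ℕ × ℕ) × ℕ) × ((ℕ × List ℤ) × (ℕ × List ℤ)) → (ℕ × List ℤ) × ℤ)
      (unitS : (ℕ × ℕ) × ℕ → (ℕ × List ℤ) × ℤ),
      CodeFP (pairE (pairE (pairE natE natE) unE) (pairE natE (rawE intE))) (pairE (pairE natE (rawE intE)) intE) rhoS ∧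
      CodeFP (pairE (pairE (pairE natE natE) unE) (pairE (pairE natE (rawE intE)) (pairE natE (rawE intE))))
        (pairE (pairE natE (rawE intE)) intE) starS ∧
      CodeFP (pairE (pairE natE natE) unE) (pairE (pairE natE (rawE intE)) intE) unitS ∧
      (∀ (a b prec : ℕ) (c : ℕ × List ℤ), rhoS (((a, b), prec), c) =
        (((fun s : ((ℕ × List ℤ) × ℤ) × Bool => if s.2 = true then s else
            (((redL (((a, b), prec), s.1.1)).1, s.1.2 + (redL (((a, b), prec), s.1.1)).2), isBigL ((a, b), (redL (((a, b), prec), s.1.1)).1))))^[7]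
          ((c, 0), false)).1) ∧
      (∀ (a b prec : ℕ) (c₁ c₂ : ℕ × List ℤ), starS (((a, b), prec), (c₁, c₂)) =
        (((fun s : ((ℕ × List ℤ) × ℤ) × Bool => if s.2 = true then s else
            (((redL (((a, b), prec), s.1.1)).1, s.1.2 + (redL (((a, b), prec), s.1.1)).2), isBigL ((a, b), (redL (((a, b), prec), s.1.1)).1))))^[6]
          (((redL (((a, b), prec), latProd ((a, b), (c₁, c₂)))).1, (redL (((a, b), prec), latProd ((a, b), (c₁, c₂)))).2),
            isBigL ((a, b), (redL (((a, b), prec), latProd ((a, b), (c₁, c₂)))).1))).1) ∧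
      (∀ (a b prec : ℕ), unitS ((a, b), prec) =
        (((fun s : ((ℕ × List ℤ) × ℤ) × Bool => if s.2 = true then s else
            (((redL (((a, b), prec), s.1.1)).1, s.1.2 + (redL (((a, b), prec), s.1.1)).2), isBigL ((a, b), (redL (((a, b), prec), s.1.1)).1))))^[6]
          ((ordL (a, b), 0), isBigL ((a, b), ordL (a, b)))).1) :=
  fun latProd ordL redL isBigL hlatProd hordL hredL hisBigL =>
    exists_cubic_loops latProd ordL redL isBigL hlatProd hordL hredL hisBigL

/-- **S3b-P4 `stub_cubicWalkOpsFP`.** Given the lattice/element programs `mulE`, `normE`, `latScale`, `latProd`,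
the unit-cylinder minimum `lexE`, the certified logarithm `logE` and the maximal order `ordL` as black boxes
(only their `CodeFP` facts and the `mulE`/`normE` specifications are assumed), polynomial-time programs for the
inverse of an element code (`invE`, by the adjugate of the cubic form), one reduction step `redL`, the exact
big-gap test `isBigL` (`0 ≤ N(10γ − 11)` through `normE`), and the three bounded loops `rhoS`, `starS`, `unitS`
(literal iterates of one step function), with their algebraic and operational specifications. -/
theorem stub_cubicWalkOpsFP :
    ∀ (mulE : (ℕ × ℕ) × ((ℤ × ℤ × ℤ × ℕ) × (ℤ × ℤ × ℤ × ℕ)) → ℤ × ℤ × ℤ × ℕ)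
      (normE : (ℕ × ℕ) × (ℤ × ℤ × ℤ × ℕ) → ℤ × ℕ)
      (latScale : (ℕ × ℕ) × ((ℕ × List ℤ) × (ℤ × ℤ × ℤ × ℕ)) → ℕ × List ℤ)
      (latProd : (ℕ × ℕ) × ((ℕ × List ℤ) × (ℕ × List ℤ)) → ℕ × List ℤ)
      (lexE : (ℕ × ℕ) × (ℕ × List ℤ) → ℤ × ℤ × ℤ × ℕ)
      (logE : (ℕ × ℕ) × ((ℤ × ℤ × ℤ × ℕ) × ℕ) → ℤ)
      (ordL : ℕ × ℕ → ℕ × List ℤ),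
      CodeFP (pairE (pairE natE natE) (pairE (pairE intE (pairE intE (pairE intE natE))) (pairE intE (pairE intE (pairE intE natE)))))
        (pairE intE (pairE intE (pairE intE natE))) mulE →
      CodeFP (pairE (pairE natE natE) (pairE intE (pairE intE (pairE intE natE)))) (pairE intE natE) normE →
      CodeFP (pairE (pairE natE natE) (pairE (pairE natE (rawE intE)) (pairE intE (pairE intE (pairE intE natE)))))
        (pairE natE (rawE intE)) latScale →
      CodeFP (pairE (pairE natE natE) (pairE (pairE natE (rawE intE)) (pairE natE (rawE intE)))) (pairE natE (rawE intE)) latProd →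
      CodeFP (pairE (pairE natE natE) (pairE natE (rawE intE))) (pairE intE (pairE intE (pairE intE natE))) lexE →
      CodeFP (pairE (pairE natE natE) (pairE (pairE intE (pairE intE (pairE intE natE))) unE)) intE logE →
      CodeFP (pairE natE natE) (pairE natE (rawE intE)) ordL →
    -- B
    (∀ (a b : ℕ), Squarefree (a * b) → a * b ≠ 1 →
      ∀ (K : Type) [Field K] [NumberField K], Module.finrank ℚ K = 3 →
        ∀ θ : K, θ ^ 3 = ((a * b ^ 2 : ℕ) : K) →
          IsIntegral ℤ θ ∧ IsIntegral ℤ (θ ^ 2 / (b : K)) ∧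
          (∀ ξ : 𝓞 K, ∃ c₀ c₁ c₂ : ℤ, (3 : K) * (ξ : K) = c₀ + c₁ * θ + c₂ * (θ ^ 2 / (b : K))) ∧
          (∀ c₀ c₁ c₂ : ℚ, (c₀ : K) + (c₁ : K) * θ + (c₂ : K) * (θ ^ 2 / (b : K)) = 0 → c₀ = 0 ∧ c₁ = 0 ∧ c₂ = 0) ∧
          (∀ x y z : ℚ, Algebra.norm ℚ ((x : K) + (y : K) * θ + (z : K) * (θ ^ 2 / (b : K))) =
            x ^ 3 + (a * b ^ 2 : ℕ) * y ^ 3 + (a ^ 2 * b : ℕ) * z ^ 3 - 3 * (a * b : ℕ) * x * y * z) ∧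
          (∀ x y z : ℚ, Algebra.trace ℚ K ((x : K) + (y : K) * θ + (z : K) * (θ ^ 2 / (b : K))) = 3 * x)) →
    -- the specifications of `mulE`, `normE` (from G1)
    (∀ (a b : ℕ), Squarefree (a * b) → a * b ≠ 1 →
      ∀ (K : Type) [Field K] [NumberField K], Module.finrank ℚ K = 3 →
        ∀ θ : K, θ ^ 3 = ((a * b ^ 2 : ℕ) : K) →
        (∀ e₁ e₂ : ℤ × ℤ × ℤ × ℕ, 1 ≤ e₁.2.2.2 → 1 ≤ e₂.2.2.2 →
          1 ≤ (mulE ((a, b), (e₁, e₂))).2.2.2 ∧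
          (((((mulE ((a, b), (e₁, e₂))).1 : ℤ) : K) + (((mulE ((a, b), (e₁, e₂))).2.1 : ℤ) : K) * θ + (((mulE ((a, b), (e₁, e₂))).2.2.1 : ℤ) : K) * (θ ^ 2 / (b : K))) /
              (((mulE ((a, b), (e₁, e₂))).2.2.2 : ℕ) : K)) =
            (((((e₁).1 : ℤ) : K) + (((e₁).2.1 : ℤ) : K) * θ + (((e₁).2.2.1 : ℤ) : K) * (θ ^ 2 / (b : K))) /
              (((e₁).2.2.2 : ℕ) : K)) *
            (((((e₂).1 : ℤ) : K) + (((e₂).2.1 : ℤ) : K) * θ + (((e₂).2.2.1 : ℤ) : K) * (θ ^ 2 / (b : K))) /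
              (((e₂).2.2.2 : ℕ) : K))) ∧
        (∀ e : ℤ × ℤ × ℤ × ℕ, 1 ≤ e.2.2.2 →
          1 ≤ (normE ((a, b), e)).2 ∧
          (((normE ((a, b), e)).1 : ℤ) : ℚ) / (((normE ((a, b), e)).2 : ℕ) : ℚ) =
            Algebra.norm ℚ (((((e).1 : ℤ) : K) + (((e).2.1 : ℤ) : K) * θ + (((e).2.2.1 : ℤ) : K) * (θ ^ 2 / (b : K))) /
              (((e).2.2.2 : ℕ) : K)))) →
    ∃ (invE : (ℕ × ℕ) × (ℤ × ℤ × ℤ × ℕ) → ℤ × ℤ × ℤ × ℕ)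
      (redL : ((ℕ × ℕ) × ℕ) × (ℕ × List ℤ) → (ℕ × List ℤ) × ℤ)
      (isBigL : (ℕ × ℕ) × (ℕ × List ℤ) → Bool)
      (rhoS : ((ℕ × ℕ) × ℕ) × (ℕ × List ℤ) → (ℕ × List ℤ) × ℤ)
      (starS : ((ℕ × ℕ) × ℕ) × ((ℕ × List ℤ) × (ℕ × List ℤ)) → (ℕ × List ℤ) × ℤ)
      (unitS : (ℕ × ℕ) × ℕ → (ℕ × List ℤ) × ℤ),
      CodeFP (pairE (pairE natE natE) (pairE intE (pairE intE (pairE intE natE)))) (pairE intE (pairE intE (pairE intE natE))) invE ∧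
      CodeFP (pairE (pairE (pairE natE natE) unE) (pairE natE (rawE intE))) (pairE (pairE natE (rawE intE)) intE) redL ∧
      CodeFP (pairE (pairE natE natE) (pairE natE (rawE intE))) bitE isBigL ∧
      CodeFP (pairE (pairE (pairE natE natE) unE) (pairE natE (rawE intE))) (pairE (pairE natE (rawE intE)) intE) rhoS ∧
      CodeFP (pairE (pairE (pairE natE natE) unE) (pairE (pairE natE (rawE intE)) (pairE natE (rawE intE))))
        (pairE (pairE natE (rawE intE)) intE) starS ∧
      CodeFP (pairE (pairE natE natE) unE) (pairE (pairE natE (rawE intE)) intE) unitS ∧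
      -- algebraic specifications (inverse, one reduction step, the big-gap test)
      (∀ (a b : ℕ), Squarefree (a * b) → a * b ≠ 1 →
        ∀ (K : Type) [Field K] [NumberField K], Module.finrank ℚ K = 3 →
          ∀ θ : K, θ ^ 3 = ((a * b ^ 2 : ℕ) : K) →
          (∀ e : ℤ × ℤ × ℤ × ℕ, 1 ≤ e.2.2.2 → (((((e).1 : ℤ) : K) + (((e).2.1 : ℤ) : K) * θ + (((e).2.2.1 : ℤ) : K) * (θ ^ 2 / (b : K))) /
              (((e).2.2.2 : ℕ) : K)) ≠ 0 →
            1 ≤ (invE ((a, b), e)).2.2.2 ∧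
            (((((invE ((a, b), e)).1 : ℤ) : K) + (((invE ((a, b), e)).2.1 : ℤ) : K) * θ + (((invE ((a, b), e)).2.2.1 : ℤ) : K) * (θ ^ 2 / (b : K))) /
              (((invE ((a, b), e)).2.2.2 : ℕ) : K)) *
              (((((e).1 : ℤ) : K) + (((e).2.1 : ℤ) : K) * θ + (((e).2.2.1 : ℤ) : K) * (θ ^ 2 / (b : K))) /
              (((e).2.2.2 : ℕ) : K)) = 1) ∧
          (∀ (prec : ℕ) (c : ℕ × List ℤ), 1 ≤ (lexE ((a, b), c)).2.2.2 → (((((lexE ((a, b), c)).1 : ℤ) : K) + (((lexE ((a, b), c)).2.1 : ℤ) : K) * θ + (((lexE ((a, b), c)).2.2.1 : ℤ) : K) * (θ ^ 2 / (b : K))) /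
              (((lexE ((a, b), c)).2.2.2 : ℕ) : K)) ≠ 0 →
            (redL (((a, b), prec), c)).1 = latScale ((a, b), (c, invE ((a, b), lexE ((a, b), c)))) ∧
            (redL (((a, b), prec), c)).2 = logE ((a, b), (lexE ((a, b), c), prec))) ∧
          (∀ c : ℕ × List ℤ, 1 ≤ (lexE ((a, b), c)).2.2.2 →
            (isBigL ((a, b), c) = true ↔
              0 ≤ Algebra.norm ℚ ((10 : K) * (((((lexE ((a, b), c)).1 : ℤ) : K) + (((lexE ((a, b), c)).2.1 : ℤ) : K) * θ + (((lexE ((a, b), c)).2.2.1 : ℤ) : K) * (θ ^ 2 / (b : K))) /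
              (((lexE ((a, b), c)).2.2.2 : ℕ) : K)) - 11)))) ∧
      -- operational specifications (the filtered baby step, the filtered giant step, the first S-point)
      (∀ (a b prec : ℕ) (c : ℕ × List ℤ), rhoS (((a, b), prec), c) =
        (((fun s : ((ℕ × List ℤ) × ℤ) × Bool => if s.2 = true then s else
            (((redL (((a, b), prec), s.1.1)).1, s.1.2 + (redL (((a, b), prec), s.1.1)).2), isBigL ((a, b), (redL (((a, b), prec), s.1.1)).1))))^[7]
          ((c, 0), false)).1) ∧
      (∀ (a b prec : ℕ) (c₁ c₂ : ℕ × List ℤ), starS (((a, b), prec), (c₁, c₂)) =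
        (((fun s : ((ℕ × List ℤ) × ℤ) × Bool => if s.2 = true then s else
            (((redL (((a, b), prec), s.1.1)).1, s.1.2 + (redL (((a, b), prec), s.1.1)).2), isBigL ((a, b), (redL (((a, b), prec), s.1.1)).1))))^[6]
          (((redL (((a, b), prec), latProd ((a, b), (c₁, c₂)))).1, (redL (((a, b), prec), latProd ((a, b), (c₁, c₂)))).2),
            isBigL ((a, b), (redL (((a, b), prec), latProd ((a, b), (c₁, c₂)))).1))).1) ∧
      (∀ (a b prec : ℕ), unitS ((a, b), prec) =
        (((fun s : ((ℕ × List ℤ) × ℤ) × Bool => if s.2 = true then s else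
            (((redL (((a, b), prec), s.1.1)).1, s.1.2 + (redL (((a, b), prec), s.1.1)).2), isBigL ((a, b), (redL (((a, b), prec), s.1.1)).1))))^[6]
          ((ordL (a, b), 0), isBigL ((a, b), ordL (a, b)))).1) := by
  intro mulE normE latScale latProd lexE logE ordL _ hnormE hlatScale hlatProd hlexE hlogE hordL hB hMN
  obtain ⟨invE, hinvE, hinv⟩ := exists_cubic_invE
  obtain ⟨isBigL, hisBigL, hbig⟩ := exists_cubic_isBigL normE lexE hnormE hlexE
  obtain ⟨redL, hredL, hred⟩ := exists_cubic_redL latScale lexE logE invE hlatScale hlexE hlogE hinvE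
  obtain ⟨rhoS, starS, unitS, hrhoS, hstarS, hunitS, hrho, hstar, hunit⟩ :=
    exists_cubic_loops latProd ordL redL isBigL hlatProd hordL hredL hisBigL
  refine ⟨invE, redL, isBigL, rhoS, starS, unitS, hinvE, hredL, hisBigL, hrhoS, hstarS, hunitS, ?_, hrho, hstar, hunit⟩
  intro a b hsf h1 K _ _ hK θ hθ
  have hb0 : (b : K) ≠ 0 := by
    have : b ≠ 0 := fun h => by rw [h, mul_zero] at hsf; exact not_squarefree_zero hsf
    exact_mod_cast this
  exact ⟨hinv a b K θ hb0 hθ (hB a b hsf h1 K hK θ hθ).2.2.2.2.1, fun prec c _ _ => hred a b prec c,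
    hbig a b K θ (hMN a b hsf h1 K hK θ hθ).2⟩

end Summit.QuantumAdvantage.QuantumAdvantage.Theorems.LinnikCubicClassGroups
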